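import Literature.MathematicalPhysics.QuantumFieldTheory.Balaban1983to89.B4Ineq120RegularRegion

/-!
# `Balaban1983to89.B4ConstantsWindow` — T. Bałaban, *Regularity and decay of lattice Green's functions*, Commun. Math.
# Phys. **89** (1983) 571–597 [Balaban1983RegularityDecay] (= B4), «Proposition 2.3 of [1]» p. 574 at a regular `A ≠ 0`:
# the constants of the regular-`A` chain BOUNDED UNIFORMLY OVER A WINDOW `a_k ∈ [a₋, a₊]`, and the smallness thresholds
# «for e sufficiently small» made uniform on the window

statement-level skeleton of published theorems with citation tags; proofs where landed; nothing here is a claim about the Yang–Mills mass gap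

PDF held: `paper:balaban1983-cmp89-regularity-decay` (journal page = PDF page + 570); pp. 573–574, 593–594 [PDF 3–4,
23–24] read on the ×2 renders `…/b2b-balaban-ref1/pages/1983-cmp89-regularity-decay/…-p0NN-x2.png`.

CITATION HEADER (lean-in-tree rule).  Cell `lit-balaban` (HOME `run/shared/lean/pub/lit-balaban/`), Phase-2 proof seat
**p17** gen 3 (unit `lit-balaban-p17-g3`), file 8a — row **B4.Prop2.3[I]** (owner r01, referee ref-4), towards closing the
HONEST-SCOPE item **G-B4-p17-01** of GAPS.md («a_k-window uniformity NOT asserted by the A ≠ 0 leaf»): p. 573 *"a_k is a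
constant proportional to a"* (along the induction `a_k` runs through a compact window of positive numbers) and p. 574
*"There exist positive constants δ₀, c₀, γ₀, γ₁ dependent on d and M only and such that for e sufficiently small"* —
constants independent of `k`, hence UNIFORM in `a_k`.  Companion files: 8b `B4Prop23WindowBounds` ((5.6), (5.9),
(1.15)–(1.20) with the uniform constants), 8c `B4Prop23RegularWindow` (the family-level leaf).

THE MECHANISM (ours; the print does not discuss it).  Every constant of the regular-`A` chain (b04 `B4Cor23Region`/
`B4Cor23RegionDelta`, p35 via file 2 `B4Ineq53RegularRegion`, files 3/4b/7 of this seat) is an explicit expression in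
`a = a_k`: `c₀(a) = c0R a = 4(1+16/min(2,a))(1+4/min(2,a))`, `δ₀(d,a) = min(2,a)/(16(d+1+a))`, `c₁(d,a) = 2e⁴(c₀ + √(c₀K₂))`
with `K₂ = K2 d (min(2,a)/4) a` (`K0 σ = 8(1+4/σ)`, `K1 σ = 16(1+4/σ)²`), `γ₀(a,m²) = 1/max((6(d+1)+2m²)/a, 24)`,
`γ₀″ = gamLow`.  §1: monotonicity (`gam0_mono`, `gamLow_mono`, `c0R_anti`, `K2_window`, `c1R_window`, `delta0R_window`,
`delta0R_le`).  §2: the window constants `c1W`, `cW`, `dW` (defs) and `consts_le`: every (5.6)/(5.9)-constant of files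
3, 4b, 7 at `a ∈ [a₋,a₊]` is `≤ cW`, every rate `≥ 2·dW`.  §3: the thresholds (`threshold_window`, `thresholdU_window`,
`hX_window`): ONE `e₁` for all `a ∈ [a₋,a₊]`.  No `Prop`-valued definition; three real constants as `def`s.

HONEST SCOPE.  `0 < a₋ ≤ a₊`, `0 ≤ m²₊`; constants depend on `(d, N, L, a₋, a₊, a′, c, β, ℓ, m²₊)` (the print's «d and M
only» silently includes `L` and the model constants, GAPS G-B4-p17-01 / census C-B5-5).  Unit `lit-balaban-p17-g3`.
-/

namespace Literature.MathematicalPhysics.QuantumFieldTheory.Balaban1983to89.B4ConstantsWindow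

open Literature.MathematicalPhysics.QuantumFieldTheory.Balaban1983to89
open Literature.MathematicalPhysics.QuantumFieldTheory.Balaban1983to89.B4Lower18Regular (threshold_exists)
open Literature.MathematicalPhysics.QuantumFieldTheory.Balaban1983to89.B4Cor23Region (c0R delta0R c0R_eq c0R_pos delta0R_pos)
open Literature.MathematicalPhysics.QuantumFieldTheory.Balaban1983to89.B4Cor23RegionDelta (K0 K1 K2 K2R c1R K0_nonneg
  K1_nonneg K2_nonneg two_c0R_le_c1R)
open Literature.MathematicalPhysics.QuantumFieldTheory.Balaban1983to89.B4Ineq53RegularRegion (gam0 gamLow gam0_pos gam0_anti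
  gamLow_pos)
open Literature.MathematicalPhysics.QuantumFieldTheory.Balaban1983to89.B4Prop23RegularRegion (c54)

noncomputable section

/-! ## §1. Monotonicity of the constants in `a = a_k` -/

section Mono

/-- `γ₀(a,m²) = 1/max((6(d+1)+2m²)/a, 24)` is monotone in `a > 0` (`m² ≥ 0`). [cite: Balaban1983RegularityDecay, (1.22) p.574] -/
theorem gam0_mono (d : ℕ) {a a₂ m2 : ℝ} (ha : 0 < a) (h : a ≤ a₂) (hm : 0 ≤ m2) : gam0 d a m2 ≤ gam0 d a₂ m2 := by
  unfold gam0
  have h0 : 0 < max ((6 * (d + 1) + 2 * m2) / a₂) 24 := lt_of_lt_of_le (by norm_num) (le_max_right _ _)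
  refine inv_anti₀ h0 (max_le_max ?_ le_rfl)
  exact div_le_div_of_nonneg_left (by positivity) ha h

/-- `γ₀·min(2, a′/γ₀)/4 = min(2γ₀, a′)/4` (`γ₀ > 0`). [folklore] -/
private theorem mul_min_div {g a' : ℝ} (hg : 0 < g) : g * (min 2 (a' / g) / 4) = min (2 * g) a' / 4 := by
  rcases le_total 2 (a' / g) with h | h
  · rw [min_eq_left h, min_eq_left (by rwa [le_div_iff₀ hg] at h)]; ring
  · rw [min_eq_right h, min_eq_right (by rwa [div_le_iff₀ hg] at h)]
    field_simp

/-- `γ₀″ = gamLow` is monotone in `a > 0` (`m²₊ ≥ 0`). [cite: Balaban1983RegularityDecay, (5.3) p.593] -/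
theorem gamLow_mono (d L : ℕ) {a a₂ a' m2max : ℝ} (ha : 0 < a) (h : a ≤ a₂) (hm : 0 ≤ m2max) :
    gamLow d L a a' m2max ≤ gamLow d L a₂ a' m2max := by
  unfold gamLow
  rw [mul_min_div (gam0_pos d a m2max), mul_min_div (gam0_pos d a₂ m2max)]
  have h1 : min (2 * gam0 d a m2max) a' ≤ min (2 * gam0 d a₂ m2max) a' :=
    min_le_min (by linarith [gam0_mono d ha h hm]) le_rfl
  exact div_le_div_of_nonneg_right (div_le_div_of_nonneg_right h1 (by norm_num)) (by positivity)

/-- `c₀(a) = c0R a` is antitone in `a > 0`. [cite: Balaban1983RegularityDecay, Cor. 2.3 (2.30) p.580] -/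
theorem c0R_anti {a a₂ : ℝ} (ha : 0 < a) (h : a ≤ a₂) : c0R a₂ ≤ c0R a := by
  rw [c0R_eq, c0R_eq]
  have hs : 0 < min 2 a := lt_min two_pos ha
  have hss : min 2 a ≤ min 2 a₂ := min_le_min le_rfl h
  have h1 : 16 / min 2 a₂ ≤ 16 / min 2 a := div_le_div_of_nonneg_left (by norm_num) hs hss
  have h2 : 4 / min 2 a₂ ≤ 4 / min 2 a := div_le_div_of_nonneg_left (by norm_num) hs hss
  have h3 : 0 ≤ 16 / min 2 a₂ := div_nonneg (by norm_num) (hs.trans_le hss).le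
  have h4 : 0 ≤ 4 / min 2 a₂ := div_nonneg (by norm_num) (hs.trans_le hss).le
  nlinarith [mul_le_mul (add_le_add_left h1 1) (add_le_add_left h2 1) (by linarith) (by linarith)]

/-- `K₀` is antitone in `σ > 0`. [folklore] -/
private theorem K0_anti {σ σ₂ : ℝ} (hσ : 0 < σ) (h : σ ≤ σ₂) : K0 σ₂ ≤ K0 σ := by
  unfold K0
  have := div_le_div_of_nonneg_left (by norm_num : (0 : ℝ) ≤ 4) hσ h
  linarith

/-- `K₁` is antitone in `σ > 0`. [folklore] -/
private theorem K1_anti {σ σ₂ : ℝ} (hσ : 0 < σ) (h : σ ≤ σ₂) : K1 σ₂ ≤ K1 σ := by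
  unfold K1
  have h1 := div_le_div_of_nonneg_left (by norm_num : (0 : ℝ) ≤ 4) hσ h
  have h2 : 0 ≤ 4 / σ₂ := div_nonneg (by norm_num) (hσ.trans_le h).le
  nlinarith

/-- `K₀(σ)/σ` is antitone in `σ > 0`. [folklore] -/
private theorem K0_div_anti {σ σ₂ : ℝ} (hσ : 0 < σ) (h : σ ≤ σ₂) : K0 σ₂ / σ₂ ≤ K0 σ / σ := by
  have hσ₂ : 0 < σ₂ := hσ.trans_le h
  calc K0 σ₂ / σ₂ ≤ K0 σ / σ₂ := div_le_div_of_nonneg_right (K0_anti hσ h) hσ₂.le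
    _ ≤ K0 σ / σ := div_le_div_of_nonneg_left (K0_nonneg hσ) hσ h

/-- `K₂(d,σ,a)` is antitone in `σ > 0` and monotone in `a ≥ 0` (b04's collar-form constant of the `δG` clause).
[cite: Balaban1983RegularityDecay, Cor. 2.3 p.581 (δG clause), constants] -/
theorem K2_window (d : ℕ) {σ σ₂ a a₂ : ℝ} (hσ : 0 < σ) (h : σ ≤ σ₂) (ha : 0 ≤ a) (ha₂ : a ≤ a₂) :
    K2 d σ₂ a ≤ K2 d σ a₂ := by
  have hσ₂ : 0 < σ₂ := hσ.trans_le h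
  have e0 := K0_anti hσ h
  have e1 := K1_anti hσ h
  have e2 := K0_div_anti hσ h
  have hK0 := K0_nonneg hσ₂
  have hKd : 0 ≤ K0 σ₂ / σ₂ := div_nonneg hK0 hσ₂.le
  unfold K2
  have h1 : Real.sqrt (K1 σ₂) ≤ Real.sqrt (K1 σ) := Real.sqrt_le_sqrt e1
  have h2 : Real.sqrt (2 * (K1 σ₂ + K0 σ₂ / σ₂)) ≤ Real.sqrt (2 * (K1 σ + K0 σ / σ)) :=
    Real.sqrt_le_sqrt (by linarith)
  have h3 : a * K0 σ₂ / σ₂ ≤ a₂ * K0 σ / σ := by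
    rw [mul_div_assoc, mul_div_assoc]
    exact mul_le_mul ha₂ e2 hKd (ha.trans ha₂)
  have h4 : ((d : ℝ) + 1) * Real.sqrt (K1 σ₂) * Real.sqrt (2 * (K1 σ₂ + K0 σ₂ / σ₂))
      ≤ ((d : ℝ) + 1) * Real.sqrt (K1 σ) * Real.sqrt (2 * (K1 σ + K0 σ / σ)) :=
    mul_le_mul (mul_le_mul_of_nonneg_left h1 (by positivity)) h2 (Real.sqrt_nonneg _) (by positivity)
  linarith

/-- **`δW ≤ δ₀(d,a)` on the window**: `min(2,a₋)/(16(d+1+a₊)) ≤ delta0R d a` for `a ∈ [a₋,a₊]`.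
[cite: Balaban1983RegularityDecay, Cor. 2.3 (2.30) p.580, rate] -/
theorem delta0R_window (d : ℕ) {aminus aplus a : ℝ} (ham : 0 < aminus) (h1 : aminus ≤ a) (h2 : a ≤ aplus) :
    min 2 aminus / (16 * ((d : ℝ) + 1 + aplus)) ≤ delta0R d a := by
  unfold delta0R
  have hs : 0 ≤ min 2 aminus := (lt_min two_pos ham).le
  have hden : 0 < 16 * ((d : ℝ) + 1 + a) := by have := ham.trans_le h1; positivity
  calc min 2 aminus / (16 * ((d : ℝ) + 1 + aplus)) ≤ min 2 aminus / (16 * ((d : ℝ) + 1 + a)) :=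
        div_le_div_of_nonneg_left hs hden (by nlinarith)
    _ ≤ min 2 a / (16 * ((d : ℝ) + 1 + a)) := div_le_div_of_nonneg_right (min_le_min le_rfl h1) hden.le

/-- `δ₀(d,a) ≤ 1/8` (`a > 0`). [cite: Balaban1983RegularityDecay, Cor. 2.3 (2.30) p.580, rate] -/
theorem delta0R_le (d : ℕ) {a : ℝ} (ha : 0 < a) : delta0R d a ≤ 1 / 8 := by
  unfold delta0R
  rw [div_le_iff₀ (by positivity)]
  have := min_le_left (2 : ℝ) a
  nlinarith

end Mono

/-! ## §2. The window constants -/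

section Consts

/-- `c1W(d,a₋,a₊) = 2e⁴(c₀(a₋) + √(c₀(a₋)·K2 d (min(2,a₋)/4) a₊))` — a bound of b04's `c₁(d,a)` uniform on `a ∈ [a₋,a₊]`.
[cite: Balaban1983RegularityDecay, Cor. 2.3 p.581 (δG clause), constants; Prop. 2.3 p.574 «constants dependent on d and M only»] -/
def c1W (d : ℕ) (aminus aplus : ℝ) : ℝ :=
  2 * Real.exp 4 * (c0R aminus + Real.sqrt (c0R aminus * K2 d (min 2 aminus / 4) aplus))

/-- `cW = (a₊²·c1W + a′L^{−2} + a₊)e^{3(L+1)/16}` — the window-uniform constant of (5.6)/(5.9).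
[cite: Balaban1983RegularityDecay, (5.4)–(5.5) pp.593–594, (5.6)/(5.9) p.594; Prop. 2.3 p.574 «constants dependent on d and M only»] -/
def cW (d L : ℕ) (aminus aplus a' : ℝ) : ℝ :=
  (aplus ^ 2 * c1W d aminus aplus + a' * ((L : ℝ) ^ 2)⁻¹ + aplus) * Real.exp (3 * ((L : ℝ) + 1) / 16)

/-- `dW = min(2,a₋)/(32(d+1+a₊))` — the window-uniform rate of (5.6)/(5.9) (half of the uniform lower bound of `δ₀(d,a)`).
[cite: Balaban1983RegularityDecay, (5.6)/(5.9) p.594, Cor. 2.3 (2.30) p.580; Prop. 2.3 p.574 «constants dependent on d and M only»] -/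
def dW (d : ℕ) (aminus aplus : ℝ) : ℝ := min 2 aminus / (16 * ((d : ℝ) + 1 + aplus)) / 2

/-- `c₁(d,a) ≤ c1W` for `a ∈ [a₋,a₊]`. [cite: Balaban1983RegularityDecay, Cor. 2.3 p.581, constants] -/
theorem c1R_window (d : ℕ) {aminus aplus a : ℝ} (ham : 0 < aminus) (h1 : aminus ≤ a) (h2 : a ≤ aplus) :
    c1R d a ≤ c1W d aminus aplus := by
  have ha : 0 < a := ham.trans_le h1
  have hσ : 0 < min 2 aminus / 4 := div_pos (lt_min two_pos ham) four_pos
  have hσσ : min 2 aminus / 4 ≤ min 2 a / 4 := div_le_div_of_nonneg_right (min_le_min le_rfl h1) (by norm_num)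
  have hc := c0R_anti ham h1
  have hK : K2R d a ≤ K2 d (min 2 aminus / 4) aplus := K2_window d hσ hσσ ha.le h2
  have hK0 : 0 ≤ K2R d a := K2_nonneg d (hσ.trans_le hσσ) ha.le
  unfold c1R c1W
  have hs : Real.sqrt (c0R a * K2R d a) ≤ Real.sqrt (c0R aminus * K2 d (min 2 aminus / 4) aplus) :=
    Real.sqrt_le_sqrt (mul_le_mul hc hK hK0 (c0R_pos ham).le)
  exact mul_le_mul_of_nonneg_left (add_le_add hc hs) (by positivity)

/-- `c₀(a) ≤ c1W` for `a ∈ [a₋,a₊]`. [cite: Balaban1983RegularityDecay, Cor. 2.3 (2.30) p.580, constants] -/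
theorem c0R_le_c1W (d : ℕ) {aminus aplus a : ℝ} (ham : 0 < aminus) (h1 : aminus ≤ a) :
    c0R a ≤ c1W d aminus aplus := by
  refine (c0R_anti ham h1).trans ?_
  unfold c1W
  have h3 : (1 : ℝ) ≤ Real.exp 4 := Real.one_le_exp (by norm_num)
  have h4 := Real.sqrt_nonneg (c0R aminus * K2 d (min 2 aminus / 4) aplus)
  nlinarith [c0R_pos ham]

/-- `cW > 0`. [cite: Balaban1983RegularityDecay, (5.6) p.594 «c₀», Prop. 2.3 p.574] -/
theorem cW_pos (d : ℕ) {L : ℕ} (hL : 1 ≤ L) {aminus aplus : ℝ} (ham : 0 < aminus) (hle : aminus ≤ aplus) {a' : ℝ}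
    (ha' : 0 < a') : 0 < cW d L aminus aplus a' := by
  unfold cW c1W
  have := c0R_pos ham
  have hL0 : (0 : ℝ) < L := by exact_mod_cast hL
  have : 0 < aplus := ham.trans_le hle
  positivity

/-- `dW > 0`. [cite: Balaban1983RegularityDecay, (5.6) p.594 «δ₀ > 0», Prop. 2.3 p.574] -/
theorem dW_pos (d : ℕ) {aminus aplus : ℝ} (ham : 0 < aminus) (hle : aminus ≤ aplus) : 0 < dW d aminus aplus := by
  unfold dW
  have := lt_min two_pos ham
  have : 0 < aplus := ham.trans_le hle
  positivity

/-- `dW ≤ δ₀(d,a)/2` for `a ∈ [a₋,a₊]`. [cite: Balaban1983RegularityDecay, Cor. 2.3 (2.30) p.580, rate] -/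
theorem dW_le (d : ℕ) {aminus aplus a : ℝ} (ham : 0 < aminus) (h1 : aminus ≤ a) (h2 : a ≤ aplus) :
    dW d aminus aplus ≤ delta0R d a / 2 := by
  unfold dW
  linarith [delta0R_window d ham h1 h2]

/-- **THE BOOKKEEPING OF THE UNIFORM CONSTANT**: every (5.6)/(5.9)-constant of files 3, 4b, 7 at `a ∈ [a₋,a₊]` is `≤ cW`:
the (5.4)-constant `c54 = (a²c₀(a) + a′L^{−2} + a)e^{δ₀L}` of `Δ^{(k)}(Ω,A) + a′L^{−2}P`, the (5.4)-constant
`(a²c₁(d,a) + a′L^{−2} + a)e^{(δ₀/2)(L+1)}` of the operator of `Ω₀` seen from `Ω^{(k)}`, and the (5.5)-constant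
`a²c₁(d,a)e^{3(δ₀/2)(L+1)}`. [cite: Balaban1983RegularityDecay, (5.4)–(5.5) pp.593–594, constants] -/
theorem consts_le (d L : ℕ) {aminus aplus a a' : ℝ} (ham : 0 < aminus) (h1 : aminus ≤ a) (h2 : a ≤ aplus)
    (ha' : 0 < a') :
    (0 ≤ c54 d L a a' ∧ c54 d L a a' ≤ cW d L aminus aplus a') ∧
    (0 ≤ (a ^ 2 * (c1R d a * (1 * 1)) + a' * ((L : ℝ) ^ 2)⁻¹ + a) * Real.exp (delta0R d a / 2 * ((L : ℝ) + 1)) ∧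
      (a ^ 2 * (c1R d a * (1 * 1)) + a' * ((L : ℝ) ^ 2)⁻¹ + a) * Real.exp (delta0R d a / 2 * ((L : ℝ) + 1))
        ≤ cW d L aminus aplus a') ∧
    (0 ≤ a ^ 2 * (c1R d a * (1 * 1)) * Real.exp (3 * (delta0R d a / 2 * ((L : ℝ) + 1))) ∧
      a ^ 2 * (c1R d a * (1 * 1)) * Real.exp (3 * (delta0R d a / 2 * ((L : ℝ) + 1))) ≤ cW d L aminus aplus a') := by
  have ha : 0 < a := ham.trans_le h1
  have hL0 : (0 : ℝ) ≤ L := Nat.cast_nonneg L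
  have hc0 := c0R_pos ha
  have hC1 : 0 ≤ c1R d a := by linarith [two_c0R_le_c1R d ha, c0R_pos ha]
  have hc1 : c1R d a ≤ c1W d aminus aplus := c1R_window d ham h1 h2
  have hc0W : c0R a ≤ c1W d aminus aplus := c0R_le_c1W d ham h1
  have hδ := delta0R_le d ha
  have hδ0 := (delta0R_pos d ha).le
  have haL : 0 ≤ a' * ((L : ℝ) ^ 2)⁻¹ := by positivity
  -- exponents
  have hexp1 : Real.exp (delta0R d a * L) ≤ Real.exp (3 * ((L : ℝ) + 1) / 16) := Real.exp_le_exp.2 (by nlinarith)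
  have hexp2 : Real.exp (delta0R d a / 2 * ((L : ℝ) + 1)) ≤ Real.exp (3 * ((L : ℝ) + 1) / 16) :=
    Real.exp_le_exp.2 (by nlinarith)
  have hexp3 : Real.exp (3 * (delta0R d a / 2 * ((L : ℝ) + 1))) ≤ Real.exp (3 * ((L : ℝ) + 1) / 16) :=
    Real.exp_le_exp.2 (by nlinarith)
  -- prefactors
  have hsq : a ^ 2 ≤ aplus ^ 2 := pow_le_pow_left₀ ha.le h2 2
  have m1 := mul_le_mul hsq hc0W hc0.le (sq_nonneg aplus)
  have m2 := mul_le_mul hsq hc1 hC1 (sq_nonneg aplus)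
  have hpre1 : a ^ 2 * (c0R a * (1 * 1)) + a' * ((L : ℝ) ^ 2)⁻¹ + a
      ≤ aplus ^ 2 * c1W d aminus aplus + a' * ((L : ℝ) ^ 2)⁻¹ + aplus := by nlinarith
  have hpre2 : a ^ 2 * (c1R d a * (1 * 1)) + a' * ((L : ℝ) ^ 2)⁻¹ + a
      ≤ aplus ^ 2 * c1W d aminus aplus + a' * ((L : ℝ) ^ 2)⁻¹ + aplus := by nlinarith
  have hpre3 : a ^ 2 * (c1R d a * (1 * 1)) ≤ aplus ^ 2 * c1W d aminus aplus + a' * ((L : ℝ) ^ 2)⁻¹ + aplus := by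
    nlinarith
  have hP0 : 0 ≤ aplus ^ 2 * c1W d aminus aplus + a' * ((L : ℝ) ^ 2)⁻¹ + aplus := by
    have : 0 ≤ a ^ 2 * (c1R d a * (1 * 1)) := by positivity
    linarith
  refine ⟨⟨by unfold c54; positivity, ?_⟩, ⟨by positivity, ?_⟩, ⟨by positivity, ?_⟩⟩
  · unfold c54 cW
    exact mul_le_mul hpre1 hexp1 (Real.exp_pos _).le hP0
  · unfold cW
    exact mul_le_mul hpre2 hexp2 (Real.exp_pos _).le hP0
  · unfold cW
    exact mul_le_mul hpre3 hexp3 (Real.exp_pos _).le hP0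

end Consts

/-! ## §3. The thresholds «for e sufficiently small», uniform on the window -/

section Thresholds

/-- the smallness of file 2 (`hsmall`), ONE `e₁` for all `a ∈ [a₋,a₊]`. [cite: Balaban1983RegularityDecay, Prop. 2.3 p.574 «for e sufficiently small»] -/
theorem threshold_window (ℓ c' : ℝ) {aminus aplus : ℝ} (ham : 0 < aminus) (hle : aminus ≤ aplus) {β : ℝ} (hβ : 0 < β)
    (d : ℕ) :
    ∃ e₁ : ℝ, 0 < e₁ ∧ ∀ e : ℝ, 0 < e → e ≤ e₁ → ∀ a : ℝ, aminus ≤ a → a ≤ aplus →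
      ℓ ^ 2 * (c' * e ^ β) ^ 2 * (d + 1) * (1 + a * (d + 1)) ≤ min 2 a / 4 := by
  have hp : 0 < 1 + aminus * ((d : ℝ) + 1) := by positivity
  have hap : 0 ≤ aplus := ham.le.trans hle
  have hq : 0 ≤ (1 + aplus * ((d : ℝ) + 1)) / (1 + aminus * ((d : ℝ) + 1)) := by positivity
  set ℓ' : ℝ := ℓ * Real.sqrt ((1 + aplus * ((d : ℝ) + 1)) / (1 + aminus * ((d : ℝ) + 1))) with hℓ'
  obtain ⟨e₁, he₁, h⟩ := threshold_exists ℓ' c' ham hβ d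
  refine ⟨e₁, he₁, fun e he hle' a h1 h2 => ?_⟩
  have h0 := h e he hle'
  have hsq : ℓ' ^ 2 * (1 + aminus * ((d : ℝ) + 1)) = ℓ ^ 2 * (1 + aplus * ((d : ℝ) + 1)) := by
    rw [hℓ', mul_pow, Real.sq_sqrt hq]
    field_simp
  have hX : 0 ≤ (c' * e ^ β) ^ 2 * ((d : ℝ) + 1) := by positivity
  have e1 : ℓ' ^ 2 * (c' * e ^ β) ^ 2 * (d + 1) * (1 + aminus * (d + 1))
      = ℓ ^ 2 * (c' * e ^ β) ^ 2 * (d + 1) * (1 + aplus * (d + 1)) := by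
    calc _ = ℓ' ^ 2 * (1 + aminus * ((d : ℝ) + 1)) * ((c' * e ^ β) ^ 2 * (d + 1)) := by ring
      _ = ℓ ^ 2 * (1 + aplus * ((d : ℝ) + 1)) * ((c' * e ^ β) ^ 2 * (d + 1)) := by rw [hsq]
      _ = _ := by ring
  have e2 : ℓ ^ 2 * (c' * e ^ β) ^ 2 * (d + 1) * (1 + a * (d + 1))
      ≤ ℓ ^ 2 * (c' * e ^ β) ^ 2 * (d + 1) * (1 + aplus * (d + 1)) := by
    have : ℓ ^ 2 * (c' * e ^ β) ^ 2 * ((d : ℝ) + 1) = ℓ ^ 2 * ((c' * e ^ β) ^ 2 * ((d : ℝ) + 1)) := by ring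
    rw [this]
    exact mul_le_mul_of_nonneg_left (by nlinarith) (mul_nonneg (sq_nonneg _) hX)
  have e3 : min 2 aminus / 4 ≤ min 2 a / 4 := div_le_div_of_nonneg_right (min_le_min le_rfl h1) (by norm_num)
  linarith

/-- the smallness `hsmallU` of file 2 (the block step, charge `a′/γ₀(a,m²₊)`), ONE `e₁` for all `a ∈ [a₋,a₊]` (`m²₊ ≥ 0`).
[cite: Balaban1983RegularityDecay, (5.3) p.593 «for e sufficiently small»] -/
theorem thresholdU_window (ℓ c' : ℝ) {aminus aplus : ℝ} (ham : 0 < aminus) (hle : aminus ≤ aplus) {a' : ℝ}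
    (ha' : 0 < a') {β : ℝ} (hβ : 0 < β) (d : ℕ) {m2max : ℝ} (hm : 0 ≤ m2max) :
    ∃ e₁ : ℝ, 0 < e₁ ∧ ∀ e : ℝ, 0 < e → e ≤ e₁ → ∀ a : ℝ, aminus ≤ a → a ≤ aplus →
      ℓ ^ 2 * (c' * e ^ β) ^ 2 * (d + 1) * (1 + (a' / gam0 d a m2max) * (d + 1))
        ≤ min 2 (a' / gam0 d a m2max) / 4 := by
  have hgp : 0 < a' / gam0 d aplus m2max := div_pos ha' (gam0_pos d aplus m2max)
  have hgg : a' / gam0 d aplus m2max ≤ a' / gam0 d aminus m2max :=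
    div_le_div_of_nonneg_left ha'.le (gam0_pos d aminus m2max) (gam0_mono d ham hle hm)
  obtain ⟨e₁, he₁, h⟩ := threshold_window ℓ c' hgp hgg hβ d
  refine ⟨e₁, he₁, fun e he hle' a h1 h2 => h e he hle' _ ?_ ?_⟩
  · exact div_le_div_of_nonneg_left ha'.le (gam0_pos d a m2max) (gam0_mono d (ham.trans_le h1) h2 hm)
  · exact div_le_div_of_nonneg_left ha'.le (gam0_pos d aminus m2max) (gam0_mono d ham h1 hm)

/-- the threshold `hX` of file 2 (the cross term of (1.22) below `γ₀″`), ONE `e₁` for all `a ∈ [a₋,a₊]` and all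
`m² ≥ 0`, against the uniform `γ₀″(a₋)`. [cite: Balaban1983RegularityDecay, (1.22) p.574, (5.2)–(5.3) p.593 «for e sufficiently small»] -/
theorem hX_window (ℓ c : ℝ) {aminus aplus : ℝ} (ham : 0 < aminus) (hle : aminus ≤ aplus) {a' : ℝ} (ha' : 0 < a')
    {β : ℝ} (hβ : 0 < β) (d L : ℕ) (hL : 1 ≤ L) (m2max : ℝ) :
    ∃ e₁ : ℝ, 0 < e₁ ∧ ∀ e : ℝ, 0 < e → e ≤ e₁ → ∀ a : ℝ, aminus ≤ a → a ≤ aplus → ∀ m2 : ℝ, 0 ≤ m2 →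
      gam0 d a m2 * (6 * (d + 1) * (a / (min 2 a / 4 + m2)) ^ 2 * (ℓ * ((3 * d + 4) * c * e ^ β)) ^ 2)
        ≤ gamLow d L aminus a' m2max := by
  set Kx : ℝ := gam0 d aplus 0 * (6 * (d + 1) * (4 * aplus / min 2 aminus) ^ 2 * (ℓ * ((3 * d + 4) * c)) ^ 2)
    with hKx
  have hγ := gamLow_pos d hL aminus ha' m2max
  have hs : 0 < min 2 aminus := lt_min two_pos ham
  have hap : 0 ≤ aplus := ham.le.trans hle
  have hKx0 : 0 ≤ Kx := by have := gam0_pos d aplus 0; positivity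
  obtain ⟨e₁, he₁, h⟩ := threshold_exists 1 (Real.sqrt Kx) (mul_pos four_pos hγ) hβ 0
  refine ⟨e₁, he₁, fun e he hle' a h1 h2 m2 hm2 => ?_⟩
  have ha : 0 < a := ham.trans_le h1
  have h1' := h e he hle'
  simp only [Nat.cast_zero, zero_add, mul_one, one_pow, one_mul] at h1'
  have hsq : (Real.sqrt Kx * e ^ β) ^ 2 = Kx * (e ^ β) ^ 2 := by rw [mul_pow, Real.sq_sqrt hKx0]
  have h2' : Kx * (e ^ β) ^ 2 ≤ gamLow d L aminus a' m2max := by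
    have h3 : (Real.sqrt Kx * e ^ β) ^ 2 ≤ (Real.sqrt Kx * e ^ β) ^ 2 * (1 + 4 * gamLow d L aminus a' m2max) :=
      le_mul_of_one_le_right (sq_nonneg _) (by linarith)
    have hmin : min 2 (4 * gamLow d L aminus a' m2max) / 4 ≤ gamLow d L aminus a' m2max := by
      have := min_le_right (2 : ℝ) (4 * gamLow d L aminus a' m2max); linarith
    linarith
  have hσ : 0 < min 2 a / 4 := div_pos (lt_min two_pos ha) four_pos
  have hg : gam0 d a m2 ≤ gam0 d aplus 0 := (gam0_anti d ha hm2).trans (gam0_mono d ha h2 le_rfl)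
  have hq1 : a / (min 2 a / 4 + m2) ≤ a / (min 2 a / 4) := div_le_div_of_nonneg_left ha.le hσ (by linarith)
  have hq2 : a / (min 2 a / 4) ≤ 4 * aplus / min 2 aminus := by
    rw [div_le_div_iff₀ hσ hs]
    have hmm : min 2 aminus ≤ min 2 a := min_le_min le_rfl h1
    nlinarith [mul_le_mul h2 hmm hs.le hap]
  have hq0 : 0 ≤ a / (min 2 a / 4 + m2) := by positivity
  have hq := hq1.trans hq2
  calc _ ≤ gam0 d aplus 0 * (6 * (d + 1) * (4 * aplus / min 2 aminus) ^ 2 * (ℓ * ((3 * d + 4) * c * e ^ β)) ^ 2) := by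
        have h0 : 0 ≤ 6 * ((d : ℝ) + 1) * (a / (min 2 a / 4 + m2)) ^ 2 * (ℓ * ((3 * d + 4) * c * e ^ β)) ^ 2 := by
          positivity
        refine mul_le_mul hg (mul_le_mul_of_nonneg_right (mul_le_mul_of_nonneg_left (pow_le_pow_left₀ hq0 hq 2)
          (by positivity)) (sq_nonneg _)) h0 (gam0_pos d aplus 0).le
    _ = Kx * (e ^ β) ^ 2 := by rw [hKx]; ring
    _ ≤ _ := h2'

end Thresholds

end

end Literature.MathematicalPhysics.QuantumFieldTheory.Balaban1983to89.B4ConstantsWindow
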